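import Summits.AtomisticToContinuum.BoseEinsteinCondensation.Theorems.BECGroundStateSOSPeriodicIRBoundFsumDCAssembly
import Summits.AtomisticToContinuum.BoseEinsteinCondensation.Theorems.BECGroundStateSOSPeriodicIRBoundFsumDCPotReduce
import Summits.AtomisticToContinuum.BoseEinsteinCondensation.Theorems.BECGroundStateSOSPeriodicIRBoundFsumDCPotPairs
import Summits.AtomisticToContinuum.BoseEinsteinCondensation.Theorems.BECGroundStateSOSPeriodicIRBoundFsumDCPotNear
import Summits.AtomisticToContinuum.BoseEinsteinCondensation.Theorems.BECGroundStateSOSPeriodicIRBoundFsumConeBlock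
import HarnessLib

/-!
# Crux `PeriodicIRBound` (stmt-AtomisticToContinuum-3972), line `fsum-phase-pencil`, stub S3
# `stub_phaseDoubleCommutator` — CLOSED

The registered stub S3 of the skeleton `Cruxes/PeriodicIRBound/Lines/fsum_phase_pencil.lean`:

`PhaseDoubleCommutator` — uniformly over every potential class `𝒱(R₀, V₁)` and window `κ`, for `ρ < ρ₀`,
eventually in `N`, every mode `k`, every `ε > 0`, some `δ > 0`, every `δ`-near-minimiser `Ψ` of the periodic
`N`-body energy at `L_N = (N/ρ)^{1/3}`:

  `Q_{E₀}(U_kΨ) = 𝓔_w[U_kΨ] − E₀‖U_kΨ‖² ≤ C·N·(‖k̃‖² + ρ) + ε`,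

`U_k = a_k†a_0 − a_0†a_{−k}` the number-conserving condensate phase quadrature. It is the composition of the landed
helper files of the line (seats c7/c8):

* symmetrisation `Q(U_kΨ) ≤ Q(U_kΨ) + Q(U_{−k}Ψ) = 𝒦 + 𝒫 − (𝒟₁ + 𝒟₂)` (form tautology, `FsumDCTautology`);
* the kinetic double commutator `𝒦 = ε_k⟨2n̂_0 − n̂_k − n̂_{−k}⟩ ≤ 2Nε_k` (`FsumDCKinetic`);
* the potential double commutator `𝒫`: slot lifts and the pair form (`FsumDCPotSlot`, `FsumDCPotPair`), far-lift
  adjointness (`FsumDCPotAdj`), pair reduction of `potForm/potRe` for Bose-symmetric functions (`FsumDCPotPairs`),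
  the exact near/far reduction in which every far term cancels (`FsumDCPotReduce`), the Bessel smoothing bounds of the
  near lifts (`FsumDCPotNear`), whence `𝒫 ≤ 16NρV₁ + 16√(2NρV₁)√(E₀ + δ)`;
* the Hartree bound `E₀ ≤ ½N(N−1)‖w‖₁/L³`, the near-minimiser defects `−𝒟ᵢ ≤ √δ·K` and the constant bookkeeping
  (`FsumDCAssembly`, constants `ρ₀ = 1`, `C = 2 + 32V₁`).
-/

noncomputable section

open MeasureTheory Filter
open scoped ENNReal NNReal ComplexConjugate BigOperators

namespace Summit.AtomisticToContinuum.BoseEinsteinCondensation.Cruxes.PeriodicIRBound.FsumPhasePencil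

open Literature.MathematicalPhysics.QuantumManyBody.BoseGas
open Summit.AtomisticToContinuum.BoseEinsteinCondensation.Theorems.PeriodicIRBound.Negative (NearMin InWindow)
open Summit.AtomisticToContinuum.BoseEinsteinCondensation.Cruxes.PeriodicIRBound.LinearPhFloorWagner.WF

/-- **S3 `stub_phaseDoubleCommutator` (registered stub of the line `fsum-phase-pencil`, CLOSED):** the phase
double commutator bound `PhaseDoubleCommutator` — the assembly `stub_fsumDCAssembly` fed with the near/far
reduction `stub_fsumDCPotReduce` (itself fed with the far-lift adjointness `stub_fsumDCPotAdj` and the pair reduction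
`stub_fsumDCPotPairs`), the pair reduction, and the near-lift smoothing bounds `stub_fsumDCPotNear`. [folklore] -/
theorem stub_phaseDoubleCommutator :
    Summit.AtomisticToContinuum.BoseEinsteinCondensation.Cruxes.PeriodicIRBound.FsumPhasePencil.PhaseDoubleCommutator :=
  stub_fsumDCAssembly (stub_fsumDCPotReduce stub_fsumDCPotAdj stub_fsumDCPotPairs) stub_fsumDCPotPairs
    stub_fsumDCPotNear

/-- Monotonicity of the near-minimiser property in the slack (local copy for this file). [folklore] -/
private theorem nearMin_mono' {N : ℕ} {w : ℝ → ℝ≥0∞} {ρ : ℝ} {δ δ' : ℝ≥0∞}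
    {Ψ : PeriodicTrialState N (sideLength ρ N)} (h : NearMin w ρ N δ Ψ) (hδ : δ ≤ δ') : NearMin w ρ N δ' Ψ :=
  le_trans (show periodicEnergy w Ψ ≤ _ from h) (add_le_add le_rfl hδ)

/-- **The phase cone block with the double commutator inserted (S2 ∧ S3).** Uniformly over every class
`𝒱(R₀, V₁)` and window `κ`: for `ρ < ρ₀`, eventually in `N`, every window mode `k`, every `ε > 0`, some `δ > 0`,
every `δ`-near-minimiser `Ψ`:
`|Re⟨U_kΨ, W_kΨ⟩| ≤ √((C N (‖k̃‖² + ρ) + ε)(2N‖k̃‖² + ε)) + ε`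
— Cauchy–Schwarz in the cone `H − E₀ ≥ 0` for the pair `(ρ_k†Ψ, U_kΨ)` (`stub_phaseConeBlock`, the f-sum
side `Q(ρ_k†Ψ) ≤ 2N‖k̃‖²`) with the phase side `Q(U_kΨ) ≤ CN(‖k̃‖² + ρ)` supplied by `stub_phaseDoubleCommutator`.
This is the `(h2, h3)` input of the skeleton's `weighted_algebra`, now unconditional. [folklore] -/
theorem abs_innerRe_phaseUp_kinCommutator_le_of_doubleCommutator :
    ∀ R₀ V₁ : ℝ, 0 < R₀ → 0 ≤ V₁ → ∀ κ : ℝ, 0 < κ →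
      ∃ ρ₀ : ℝ, 0 < ρ₀ ∧ ∃ C : ℝ, 0 < C ∧ ∀ ρ : ℝ, 0 < ρ → ρ < ρ₀ → ∀ᶠ N : ℕ in atTop,
        ∀ w : ℝ → ℝ≥0∞, InClass R₀ V₁ w →
          periodicGroundStateEnergy w N (sideLength ρ N) ≠ ⊤ →
          ∀ k : Fin 3 → ℤ, InWindow κ ρ N k → ∀ ε : ℝ, 0 < ε → ∃ δ : ℝ≥0∞, 0 < δ ∧
            ∀ Ψ : PeriodicTrialState N (sideLength ρ N), NearMin w ρ N δ Ψ →
              |innerRe (sideLength ρ N) (phaseUp (sideLength ρ N) k Ψ.ψ)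
                  (kinCommutator (sideLength ρ N) k Ψ.ψ)| ≤
                Real.sqrt ((C * N * (‖waveVector (sideLength ρ N) k‖ ^ 2 + ρ) + ε) *
                    (2 * N * ‖waveVector (sideLength ρ N) k‖ ^ 2 + ε)) + ε := by
  intro R₀ V₁ hR₀ hV₁ κ hκ
  obtain ⟨ρ₀, hρ₀, C, hC, H3⟩ := stub_phaseDoubleCommutator R₀ V₁ hR₀ hV₁ κ hκ
  refine ⟨ρ₀, hρ₀, C, hC, fun ρ hρ hρlt => ?_⟩
  filter_upwards [H3 ρ hρ hρlt, eventually_gt_atTop 0] with N HN hNpos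
  intro w hw hE k hk ε hε
  have hL : 0 < sideLength ρ N := sideLength_pos_of_pos hρ hNpos
  have hwfr : IsRepulsiveFiniteRange w := ⟨hw.1, R₀, hw.2.1⟩
  have hwint : (∫⁻ x : Space, w ‖x‖) ≠ ⊤ := ne_top_of_le_ne_top ENNReal.ofReal_ne_top hw.2.2
  obtain ⟨δ₂, hδ₂, P2⟩ := stub_phaseConeBlock w hwfr hwint N (sideLength ρ N) hL hE k hk.1 ε hε
  obtain ⟨δ₃, hδ₃, P3⟩ := HN w hw hE k hk ε hε
  refine ⟨min δ₂ δ₃, lt_min hδ₂ hδ₃, fun Ψ hΨ => ?_⟩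
  have h2 := P2 Ψ (nearMin_mono' hΨ (min_le_left _ _))
  have h3 := P3 Ψ (nearMin_mono' hΨ (min_le_right _ _))
  have hB : 0 ≤ 2 * (N : ℝ) * ‖waveVector (sideLength ρ N) k‖ ^ 2 + ε := by positivity
  have hs := Real.sqrt_le_sqrt (mul_le_mul_of_nonneg_right h3 hB)
  linarith

end Summit.AtomisticToContinuum.BoseEinsteinCondensation.Cruxes.PeriodicIRBound.FsumPhasePencil

end
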